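import Mathlib
import HarnessLib

/-!
# Route `DiophantineDichotomy`, crux `KhovanskiiApproxTypeEv` (stmt-Schanuel-14972), line `lambert-liouville-kill`:
# stub `stub_challengerDist` — sup-norm distance of the Lambert challenger `(1, p/q, α, q/(kp))`

Crux `Summit.Schanuel.Schanuel.Theses.DiophantineDichotomy.KhovanskiiApproxTypeEv` (item stmt-Schanuel-14972),
certificate line `lambert-liouville-kill` (skeleton `Cruxes/KhovanskiiApproxTypeEv/Lines/lambert_liouville_kill.lean`,
lead `prover-line-stmt-Schanuel-14972-a1-0`), registered stub `stub_challengerDist` (landed `--supports stmt-Schanuel-14972`).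

STUB 5 of the rank-2 certificate `notLiouville_lambert_of_ev`: at the free Khovanskii point
`θ = (1, x, e, eˣ)` with `k x eˣ = 1` (so `eˣ = 1/(kx)`), the challenger `γ = (1, p/q, α, q/(kp))`
with `x/2 ≤ p/q` satisfies, in the sup (pi) norm on `Fin 2 ⊕ Fin 2 → ℂ`,
`‖γ − θ‖ ≤ max (‖e − α‖) ((1 + 2/(kx²)) |x − p/q|)`.  Coordinatewise: `|1 − 1| = 0`,
`|p/q − x| ≤ (1 + 2/(kx²)) |x − p/q|` (factor `≥ 1`), `‖α − e‖ = ‖e − α‖`, and the Lambert slot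
`|q/(kp) − eˣ| = |1/(k (p/q)) − 1/(kx)| = |x − p/q| / (k x (p/q)) ≤ (2/(kx²)) |x − p/q|`
(denominator `k x (p/q) ≥ k x (x/2) > 0`).  Mathlib only (`pi_norm_le_iff_of_nonneg`). [folklore]
-/

noncomputable section

-- `Summit.Schanuel.Schanuel.…` is the mandated summit/sub-problem namespace (single-conjunct summit), hence:
set_option linter.dupNamespace false

namespace Summit.Schanuel.Schanuel.Cruxes.KhovanskiiApproxTypeEv.LambertLiouvilleKill

open Polynomial

/-- The trivial slot: `|r − x| ≤ (1 + 2/(kx²)) |x − r|` for `0 ≤ k` (the factor is `≥ 1`). -/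
theorem abs_sub_le_lambertFactor_mul (k x r : ℝ) (hk : 0 ≤ k) :
    |r - x| ≤ (1 + 2 / (k * x ^ 2)) * |x - r| := by
  rw [abs_sub_comm]
  have h0 : 0 ≤ 2 / (k * x ^ 2) := by positivity
  have h1 : 0 ≤ |x - r| := abs_nonneg _
  nlinarith

/-- The Lambert slot: for `0 < k`, `0 < x`, `x/2 ≤ r`,
`|1/(k r) − 1/(k x)| ≤ (2/(k x²)) |x − r|`, since `1/(kr) − 1/(kx) = (x − r)/(k r x)` and
`k r x ≥ k x²/2 > 0`. -/
theorem abs_inv_sub_inv_le_lambert (k x r : ℝ) (hk : 0 < k) (hx : 0 < x) (hr : x / 2 ≤ r) :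
    |1 / (k * r) - 1 / (k * x)| ≤ 2 / (k * x ^ 2) * |x - r| := by
  have hr0 : 0 < r := lt_of_lt_of_le (by positivity) hr
  have hkrx : 0 < k * r * x := by positivity
  have hrepr : 1 / (k * r) - 1 / (k * x) = (x - r) / (k * r * x) := by
    field_simp
  rw [hrepr, abs_div, abs_of_pos hkrx, div_mul_eq_mul_div, le_div_iff₀ (by positivity),
    div_mul_eq_mul_div, div_le_iff₀ hkrx]
  -- |x - r| * (k * x ^ 2) ≤ 2 * |x - r| * (k * r * x)
  have h1 : 0 ≤ |x - r| := abs_nonneg _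
  have h2 : k * x ^ 2 ≤ 2 * (k * r * x) := by
    have : x ≤ 2 * r := by linarith
    have hkx : 0 ≤ k * x := by positivity
    nlinarith
  nlinarith

/-- The Lambert slot, strengthened to the common factor: for `0 < k`, `0 < x`, `x/2 ≤ r`,
`|1/(k r) − 1/(k x)| ≤ (1 + 2/(k x²)) |x − r|`. -/
theorem abs_inv_sub_inv_le_lambertFactor_mul (k x r : ℝ) (hk : 0 < k) (hx : 0 < x)
    (hr : x / 2 ≤ r) :
    |1 / (k * r) - 1 / (k * x)| ≤ (1 + 2 / (k * x ^ 2)) * |x - r| := by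
  refine (abs_inv_sub_inv_le_lambert k x r hk hx hr).trans ?_
  have h1 : 0 ≤ |x - r| := abs_nonneg _
  nlinarith

/-- **STUB 5 (distance of the challenger).**  With `eˣ = 1/(kx)` (from `k x eˣ = 1`) and
`x/2 ≤ p/q`: `|q/(kp) − eˣ| = |x − p/q| / (k x (p/q)) ≤ (2/(k x²)) |x − p/q|`, so in the sup norm
`‖γ − θ‖ ≤ max(|e − α|, (1 + 2/(kx²)) |x − p/q|)`, `θ = (1, x, e, eˣ)`, `γ = (1, p/q, α, q/(kp))`.
Proof: `pi_norm_le_iff_of_nonneg`, then the four coordinates separately, the two real ones pushed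
to `ℝ` via `Complex.ofReal_exp`/`Complex.norm_real`. [folklore] -/
theorem stub_challengerDist :
    ∀ (k p q : ℕ) (x : ℝ) (α : ℂ), 1 ≤ k → 0 < x → (k : ℝ) * x * Real.exp x = 1 → 1 ≤ p → 1 ≤ q →
      x / 2 ≤ (p : ℝ) / q →
      ‖Sum.elim ![(1 : ℂ), (p : ℂ) / q] ![α, (q : ℂ) / (k * p)] -
          Sum.elim ![(1 : ℂ), (x : ℂ)] (Complex.exp ∘ ![(1 : ℂ), (x : ℂ)])‖ ≤
        max ‖Complex.exp 1 - α‖ ((1 + 2 / ((k : ℝ) * x ^ 2)) * |x - (p : ℝ) / q|) := by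
  intro k p q x α hk hx0 hx hp hq hwin
  have hkpos : (0 : ℝ) < k := by exact_mod_cast (show 0 < k by omega)
  have hppos : (0 : ℝ) < p := by exact_mod_cast (show 0 < p by omega)
  have hqpos : (0 : ℝ) < q := by exact_mod_cast (show 0 < q by omega)
  -- `eˣ = 1/(kx)`
  have hexp : Real.exp x = 1 / ((k : ℝ) * x) := by
    rw [eq_div_iff (by positivity)]
    linarith [hx]
  -- `q/(kp) = 1/(k (p/q))`
  have hslot : (q : ℝ) / (k * p) = 1 / ((k : ℝ) * ((p : ℝ) / q)) := by
    field_simp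
  have hR : 0 ≤ max ‖Complex.exp 1 - α‖ ((1 + 2 / ((k : ℝ) * x ^ 2)) * |x - (p : ℝ) / q|) :=
    (norm_nonneg _).trans (le_max_left _ _)
  refine (pi_norm_le_iff_of_nonneg hR).mpr ?_
  rintro (i | i) <;> fin_cases i
  · -- slot `inl 0`: `1 − 1 = 0`
    simp
  · -- slot `inl 1`: `p/q − x`
    refine le_max_of_le_right ?_
    have hcast : ((p : ℂ) / q - (x : ℂ)) = (((p : ℝ) / q - x : ℝ) : ℂ) := by push_cast; rfl
    simp only [Fin.mk_one, Pi.sub_apply, Sum.elim_inl, Matrix.cons_val_one, Matrix.cons_val_fin_one]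
    rw [hcast, Complex.norm_real, Real.norm_eq_abs]
    exact abs_sub_le_lambertFactor_mul k x _ hkpos.le
  · -- slot `inr 0`: `α − e`
    refine le_max_of_le_left ?_
    simp [norm_sub_rev]
  · -- slot `inr 1`: `q/(kp) − eˣ`
    refine le_max_of_le_right ?_
    have hcast : ((q : ℂ) / (k * p) - Complex.exp (x : ℂ)) =
        (((q : ℝ) / (k * p) - Real.exp x : ℝ) : ℂ) := by
      push_cast
      rfl
    simp only [Fin.mk_one, Pi.sub_apply, Sum.elim_inr, Matrix.cons_val_one, Matrix.cons_val_fin_one,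
      Function.comp_apply]
    rw [hcast, Complex.norm_real, Real.norm_eq_abs, hslot, hexp]
    exact abs_inv_sub_inv_le_lambertFactor_mul k x _ hkpos hx0 hwin

end Summit.Schanuel.Schanuel.Cruxes.KhovanskiiApproxTypeEv.LambertLiouvilleKill

end
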